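import Mathlib
import Summits.ResolutionOfSingularities.ResolutionOfSingularities.Theorems.RadicialJungCleanModelsCleanLU3CompositeCdiv
import Literature.AlgebraicGeometry.Resolution.ResolutionLU
import Literature.AlgebraicGeometry.Resolution.ResolutionOfSingularities
import HarnessLib

/-!
# Route `RadicialJung`, crux `CleanModels` (stmt-15917), stub `stub_cleanLU3DefectNonDiscrete`: **the (C-div) slice WITHOUT F-78**
# — the general divisorial case modulo `hEmb` (F-32) and `CossartPiltant2019` (F-02) only

Lead `res-B-lead-1` g8 (Sketch rev 31).  OURS; nothing here proves resolution in characteristic `p`.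

The landed general divisorial theorem ✓ `cleanLU3Defect_of_divisorialCoarsening` (`…CleanLU3CompositeCdiv.lean`, lead g5) consumes the
named fact F-78 `CossartJannsenSaito2020General` (resolution of reduced excellent schemes of dimension `≤ 2`) at exactly ONE place: to find,
along the composite valuation `O`, a finitely generated `k`-model `A₃ ⊇ A ∪ {y₀, y₁}` regular at the centre of `O`
(✓ `exists_regular_model_containing`, through Cossart–Piltant 2019 Prop. 4.10 / Novacoski–Spivakovsky over the excellent base `locAtCentre A O`).
But `A ∪ {y₀, y₁}` generates a finitely generated `k`-subalgebra of the function field `K` of dimension `3`, and local uniformization of such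
models along ANY valuation ring is already a corollary of the named fact F-02 `CossartPiltant2019` (Cossart–Piltant 2019, Thm. 1.1: resolution of
reduced separated schemes of finite type and dimension `≤ 3` over a field), read off by the valuative criterion: ✓ `CossartPiltant2019.lu3`
(`Literature/…/Resolution/ResolutionLU.lean`).  Since F-02 is an input of the skeleton anyway (T-slice, (C-curve) slice), the (C-div) slice needs
NO input of its own beyond `hEmb`:

* `exists_regular_model_containing_of_cp` — the F-02 form of ✓ `exists_regular_model_containing` (no coarsening, no regularity or dimension
  hypothesis at the centre, any valuation ring `O ⊇ A`);
* `cleanLU3Defect_of_divisorialCoarsening_of_cleanMono_cp` — ✓ `cleanLU3Defect_of_divisorialCoarsening_of_cleanMono` with `h78` replaced by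
  `hCP : CossartPiltant2019` (same proof, one call changed) and the now idle hypothesis `hreg` (regularity of `locAtCentre A O`) DROPPED;
* `cleanLU3Defect_of_divisorialCoarsening_cp` — ✓ `cleanLU3Defect_of_divisorialCoarsening` with `h78` replaced by `hCP` and the binder `hreg`
  dropped (statement otherwise byte-identical); consumed by `Cruxes/CleanModels/Lines/Sketch.lean` rev 31, which drops the printed stub `stub_cjs2020General` (F-78).
-/

noncomputable section

set_option linter.dupNamespace false -- mandated namespace of this single-conjunct summit

open IsLocalRing AlgebraicGeometry CategoryTheory
open Literature.AlgebraicGeometry.Resolution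

namespace Summit.ResolutionOfSingularities.ResolutionOfSingularities.Theorems.RadicialJung.CleanModels

variable {K : Type} [Field K] {k : Type} [Field k] [Algebra k K]

/-- **A regular model containing prescribed elements, by local uniformization from resolution of threefolds** (Cossart–Piltant 2019,
Thm. 1.1, through ✓ `CossartPiltant2019.lu3`): for a finitely generated `k`-model `A ⊆ O` of `K = Frac A` of dimension `≤ 3`, ANY valuation
ring `O` and a finite `t ⊆ O`, some finitely generated `k`-model `A₃ ⊇ A ∪ t` inside `O` is regular at the centre of `O`.  The F-02 form of
✓ `exists_regular_model_containing` (which used F-78 along a composite valuation). [cite: CossartPiltant2019, Thm. 1.1 and §4.1 (LU)] -/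
theorem exists_regular_model_containing_of_cp (hCP : CossartPiltant2019.{0})
    (O : ValuationSubring K) (A : Subalgebra k K) (hAO : A.toSubring ≤ O.toSubring) (hAfg : A.FG) [IsFractionRing A K]
    (hdimA : ringKrullDim A ≤ 3) (t : Finset K) (htO : (↑t : Set K) ⊆ O) :
    ∃ A₃ : Subalgebra k K, A₃.toSubring ≤ O.toSubring ∧ A ≤ A₃ ∧ A₃.FG ∧ (↑t : Set K) ⊆ A₃ ∧
      IsRegularLocalRing (locAtCentre A₃.toSubring O) := by
  classical
  -- the `k`-model `R = A[t]`
  obtain ⟨R, hReq, hAR, hRfg⟩ := exists_subalgebra_closure A t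
  have htR : (↑t : Set K) ⊆ R := fun z hz => by
    change z ∈ R.toSubring
    rw [hReq]
    exact Subring.subset_closure (Or.inr hz)
  have hRO : R.toSubring ≤ O.toSubring := by
    rw [hReq, Subring.closure_le]
    rintro z (hz | hz)
    · exact hAO hz
    · exact htO hz
  haveI hRfrac : IsFractionRing R K := isFractionRing_of_le hAR inferInstance
  have hdimR : ringKrullDim R ≤ 3 := by
    rw [ringKrullDim_eq_of_fg_of_le hAfg (hRfg hAfg) hAR]; exact hdimA
  -- local uniformization along `O` (Cossart–Piltant 2019, Thm. 1.1)
  obtain ⟨A₃, hA₃O, hRA₃, hA₃fg, hreg⟩ := hCP.lu3 k K O R hRO (hRfg hAfg) hRfrac hdimR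
  refine ⟨A₃, hA₃O, hAR.trans hRA₃, hA₃fg, fun z hz => hRA₃ (htR hz), ?_⟩
  exact (isRegularLocalRing_locAtCentre_iff hA₃O).mpr hreg

/-- **(C-div), general divisorial case, modulo `hEmb`, `CossartPiltant2019` and the downstairs package `hD2`** — ✓
`cleanLU3Defect_of_divisorialCoarsening_of_cleanMono` with F-78 replaced by F-02 (the regular model `A₃ ⊇ A ∪ {y₀, y₁}` along `O` now comes from
`exists_regular_model_containing_of_cp`); the rest of the proof is unchanged: `A₃` has dimension `3`, the centre of `O₁` on `locAtCentre A₃ O`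
has height one (✓ `locAtCentre_locAtCentre_eq_of_residually_independent`), and ✓ `cleanLU3Defect_of_heightOneCoarsening_of_cleanMono` concludes.
[cite: CossartPiltant2019, Thm. 1.1] -/
theorem cleanLU3Defect_of_divisorialCoarsening_of_cleanMono_cp
    (hEmb : ∀ (Z : Scheme.{0}) [IsIntegral Z] [IsNoetherian Z], Scheme.IsRegular Z →
      Scheme.IsExcellent Z → ∀ (X : Set Z), IsClosed X → X ≠ Set.univ → topologicalKrullDim X ≤ 2 →
        ∃ (Z' : Scheme.{0}) (π : Z' ⟶ Z), IsProper π ∧ Function.Surjective π.base ∧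
          (∃ U : Z.Opens, (U : Set Z) = Xᶜ ∧ IsIso (π ∣_ U)) ∧
          IsStrictNormalCrossingsDivisor Z' (π.base ⁻¹' X))
    (hCP : CossartPiltant2019.{0})
    (p : ℕ) (hp : p.Prime) (k : Type) [Field k] [CharP k p]
    (hD2 : ∀ (κ : Type) [Field κ] [CharP κ p] [Algebra k κ]
      (Ō : ValuationSubring κ) (Ā : Subalgebra k κ), Ā.toSubring ≤ Ō.toSubring → Ā.FG → IsFractionRing Ā κ →
      IsRegularLocalRing (locAtCentre Ā.toSubring Ō) →
      ringKrullDim (locAtCentre Ā.toSubring Ō) = 2 →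
      (∀ (T : Subring κ) (hT : T ≤ Ō.toSubring), Ā.toSubring ≤ T → (subringCentre T Ō hT).IsMaximal) →
      ∀ ū : κ, (∀ c : κ, c ^ p ≠ ū) →
      ∃ (Rb : ℕ → Subring κ), Rb 0 = locAtCentre Ā.toSubring Ō ∧ (∀ i, IsQuadraticTransformAlong Ō (Rb i) (Rb (i + 1))) ∧
        ∃ (M : ℕ) (_ : IsRegularLocalRing (Rb M)), ringKrullDim (Rb M) = 2 ∧
        ∃ (c : Fin p → κ), (∃ j : Fin p, (j : ℕ) ≠ 0 ∧ c j ≠ 0) ∧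
        ∃ (xb yb : Rb M), (xb : κ) ≠ 0 ∧ (yb : κ) ≠ 0 ∧ maximalIdeal (Rb M) = Ideal.span {xb, yb} ∧
        ∃ (Lb : List (κ × κ × ℕ)),
          (∀ t ∈ Lb, t.1 ≠ 0 ∧ ∃ (h₁ : t.1 ∈ Rb M) (h₂ : t.2.1 ∈ Rb M), maximalIdeal (Rb M) = Ideal.span {⟨_, h₁⟩, ⟨_, h₂⟩}) ∧
          (∀ j : Fin p, c j * (Lb.map fun t => t.1 ^ t.2.2).prod ∈ Rb M) ∧
          ((∃ (a b : ℕ) (ε : Rb M), IsUnit ε ∧ (a ≠ 0 ∨ b ≠ 0) ∧ (a = 0 ∨ ¬ p ∣ a) ∧ (b = 0 ∨ ¬ p ∣ b) ∧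
              (∑ j : Fin p, c j ^ p * ū ^ (j : ℕ)) = (ε : κ) * (xb : κ) ^ a * (yb : κ) ^ b) ∨
            (∃ w : Rb M, IsUnit w ∧ (∑ j : Fin p, c j ^ p * ū ^ (j : ℕ)) = (w : κ) ∧ ∀ c' : Rb M, w - c' ^ p ∉ maximalIdeal (Rb M)) ∨
            (∃ s c' : Rb M, (∑ j : Fin p, c j ^ p * ū ^ (j : ℕ)) = (s : κ) ∧ s - c' ^ p ∈ maximalIdeal (Rb M) ∧
              s - c' ^ p ∉ maximalIdeal (Rb M) ^ 2)))
    (K : Type) [Field K] [Algebra k K]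
    (O : ValuationSubring K) (A : Subalgebra k K) (hAO : A.toSubring ≤ O.toSubring) (hAfg : A.FG)
    (hfrac : IsFractionRing A K)
    (hdim3 : ringKrullDim (locAtCentre A.toSubring O) = 3)
    (hzd : ∀ (T : Subring K) (hT : T ≤ O.toSubring), A.toSubring ≤ T → (subringCentre T O hT).IsMaximal)
    (g₀ : K) (hg₀ : ∀ c : K, c ^ p ≠ g₀)
    (hdefect : ∀ f₀ : K, ∃ f₁ : K, O.valuation (g₀ - f₁ ^ p) < O.valuation (g₀ - f₀ ^ p))
    (O₁ : ValuationSubring K) (hOO₁ : O ≤ O₁) (hO₁ : O₁ ≠ ⊤)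
    (y : Fin 2 → K) (hy : ∀ i, y i ∈ O)
    (hind : ∀ P : MvPolynomial (Fin 2) k, P ≠ 0 → O₁.valuation (MvPolynomial.aeval y P) = 1) :
    ∃ (A' : Subalgebra k K), A'.toSubring ≤ O.toSubring ∧ A ≤ A' ∧ A'.FG ∧
    ∃ (_ : IsRegularLocalRing (locAtCentre A'.toSubring O)) (c : Fin p → K), (∃ j : Fin p, (j : ℕ) ≠ 0 ∧ c j ≠ 0) ∧
    ((∃ (d m : ℕ) (hmd : m ≤ d) (t : Fin d → ↥(locAtCentre A'.toSubring O)) (a : Fin m → ℕ) (u : ↥(locAtCentre A'.toSubring O)), IsUnit u ∧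
    Ideal.span (Set.range t) = IsLocalRing.maximalIdeal ↥(locAtCentre A'.toSubring O) ∧
    ringKrullDim ↥(locAtCentre A'.toSubring O) = (d : WithBot ℕ∞) ∧ 0 < m ∧ (∀ i, ¬ p ∣ a i) ∧
    (∑ j : Fin p, c j ^ p * g₀ ^ (j : ℕ)) = (u : K) * ∏ i : Fin m, ((t (Fin.castLE hmd i) : ↥(locAtCentre A'.toSubring O)) : K) ^ (a i)) ∨
    (∃ u : ↥(locAtCentre A'.toSubring O), IsUnit u ∧ (∑ j : Fin p, c j ^ p * g₀ ^ (j : ℕ)) = (u : K) ∧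
    ∀ c' : ↥(locAtCentre A'.toSubring O), u - c' ^ p ∉ IsLocalRing.maximalIdeal ↥(locAtCentre A'.toSubring O)) ∨
    (∃ s c' : ↥(locAtCentre A'.toSubring O), (∑ j : Fin p, c j ^ p * g₀ ^ (j : ℕ)) = (s : K) ∧
    s - c' ^ p ∈ IsLocalRing.maximalIdeal ↥(locAtCentre A'.toSubring O) ∧
    s - c' ^ p ∉ IsLocalRing.maximalIdeal ↥(locAtCentre A'.toSubring O) ^ 2)) := by
  classical
  haveI : IsFractionRing A K := hfrac
  -- dimension of `A`
  have hdimA : ringKrullDim A = 3 := by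
    rw [← ringKrullDim_locAtCentre_eq_of_isMaximal A hAfg O hAO (hzd _ hAO le_rfl)]; exact hdim3
  -- a regular model `A₃ ⊇ A ∪ {y₀, y₁}` along `O` (F-02)
  obtain ⟨A₃, hA₃O, hAA₃, hA₃fg, hyA₃, hreg₃⟩ := exists_regular_model_containing_of_cp hCP O A hAO hAfg hdimA.le
    (Finset.univ.image y) (by
      intro z hz
      rw [Finset.coe_image] at hz
      obtain ⟨i, -, rfl⟩ := hz
      exact hy i)
  have hyA₃' : ∀ i, y i ∈ A₃ := fun i => hyA₃ (by
    rw [Finset.coe_image]; exact ⟨i, Finset.mem_coe.mpr (Finset.mem_univ i), rfl⟩)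
  haveI hfrac₃ : IsFractionRing A₃ K := isFractionRing_of_le hAA₃ hfrac
  have hzd₃ : ∀ (T : Subring K) (hT : T ≤ O.toSubring), A₃.toSubring ≤ T → (subringCentre T O hT).IsMaximal :=
    fun T hT h => hzd T hT (le_trans (fun z hz => hAA₃ hz) h)
  -- dimensions
  have hdimA₃ : ringKrullDim A₃ = 3 := by
    rw [ringKrullDim_eq_of_fg_of_le hAfg hA₃fg hAA₃]; exact hdimA
  have hdim3₃ : ringKrullDim (locAtCentre A₃.toSubring O) = 3 := by
    rw [ringKrullDim_locAtCentre_eq_of_isMaximal A₃ hA₃fg O hA₃O (hzd₃ _ hA₃O le_rfl)]; exact hdimA₃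
  -- the centre of `O₁` on `locAtCentre A₃ O` has height one
  have hloc₃ : locAtCentre (locAtCentre A₃.toSubring O) O₁ = O₁.toSubring :=
    locAtCentre_locAtCentre_eq_of_residually_independent hOO₁ hO₁ A₃ hA₃O hA₃fg hreg₃ hdimA₃ y hyA₃' hind
  obtain ⟨A', hA'O, hA₃A', hA'fg, hrest⟩ := cleanLU3Defect_of_heightOneCoarsening_of_cleanMono hEmb p hp k hD2 K O A₃
    hA₃O hA₃fg hfrac₃ hreg₃ hdim3₃ hzd₃ g₀ hg₀ hdefect O₁ hOO₁ hO₁ hloc₃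
  exact ⟨A', hA'O, hAA₃.trans hA₃A', hA'fg, hrest⟩

/-- **(C-div), GENERAL DIVISORIAL CASE — THEOREM modulo `hEmb` (F-32) and `hCP : CossartPiltant2019` (F-02) only** — ✓
`cleanLU3Defect_of_divisorialCoarsening` with F-78 `CossartJannsenSaito2020General` replaced by F-02 `CossartPiltant2019` and WITHOUT the hypothesis `hreg` (local uniformization from F-02 needs no
regularity of the given model); statement otherwise identical: at a zero-dimensional `O` with a 3-dimensional regular finitely generated centre, `g₀ ∉ K^p` without best `p`-th-power approximation,
and a DIVISORIAL coarsening `O ≤ O₁ ≠ K` (two elements of `O` residually algebraically independent in `κ(O₁)`), some finitely generated model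
`A' ⊇ A` inside `O`, regular at the centre, carries a loosely clean representative of the `K^p`-line of `g₀`.  Composition of
`cleanLU3Defect_of_divisorialCoarsening_of_cleanMono_cp` with the landed downstairs package (✓ `exists_cleanMono_stage_of_cases` over ✓
`stub_cleanLU2`, ✓ `stub_persistCases`, ✓ `stub_persistE1`, ✓ `stub_persistE2`), exactly as in `…CleanLU3CompositeCdiv.lean`. [folklore] -/
theorem cleanLU3Defect_of_divisorialCoarsening_cp
    (hEmb : ∀ (Z : Scheme.{0}) [IsIntegral Z] [IsNoetherian Z], Scheme.IsRegular Z →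
      Scheme.IsExcellent Z → ∀ (X : Set Z), IsClosed X → X ≠ Set.univ → topologicalKrullDim X ≤ 2 →
        ∃ (Z' : Scheme.{0}) (π : Z' ⟶ Z), IsProper π ∧ Function.Surjective π.base ∧
          (∃ U : Z.Opens, (U : Set Z) = Xᶜ ∧ IsIso (π ∣_ U)) ∧
          IsStrictNormalCrossingsDivisor Z' (π.base ⁻¹' X))
    (hCP : CossartPiltant2019.{0})
    (p : ℕ) (hp : p.Prime) (k : Type) [Field k] [CharP k p] (K : Type) [Field K] [Algebra k K]
    (O : ValuationSubring K) (A : Subalgebra k K) (hAO : A.toSubring ≤ O.toSubring) (hAfg : A.FG)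
    (hfrac : IsFractionRing A K)
    (hdim3 : ringKrullDim (locAtCentre A.toSubring O) = 3)
    (hzd : ∀ (T : Subring K) (hT : T ≤ O.toSubring), A.toSubring ≤ T → (subringCentre T O hT).IsMaximal)
    (g₀ : K) (hg₀ : ∀ c : K, c ^ p ≠ g₀)
    (hdefect : ∀ f₀ : K, ∃ f₁ : K, O.valuation (g₀ - f₁ ^ p) < O.valuation (g₀ - f₀ ^ p))
    (O₁ : ValuationSubring K) (hOO₁ : O ≤ O₁) (hO₁ : O₁ ≠ ⊤)
    (y : Fin 2 → K) (hy : ∀ i, y i ∈ O)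
    (hind : ∀ P : MvPolynomial (Fin 2) k, P ≠ 0 → O₁.valuation (MvPolynomial.aeval y P) = 1) :
    ∃ (A' : Subalgebra k K), A'.toSubring ≤ O.toSubring ∧ A ≤ A' ∧ A'.FG ∧
    ∃ (_ : IsRegularLocalRing (locAtCentre A'.toSubring O)) (c : Fin p → K), (∃ j : Fin p, (j : ℕ) ≠ 0 ∧ c j ≠ 0) ∧
    ((∃ (d m : ℕ) (hmd : m ≤ d) (t : Fin d → ↥(locAtCentre A'.toSubring O)) (a : Fin m → ℕ) (u : ↥(locAtCentre A'.toSubring O)), IsUnit u ∧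
    Ideal.span (Set.range t) = IsLocalRing.maximalIdeal ↥(locAtCentre A'.toSubring O) ∧
    ringKrullDim ↥(locAtCentre A'.toSubring O) = (d : WithBot ℕ∞) ∧ 0 < m ∧ (∀ i, ¬ p ∣ a i) ∧
    (∑ j : Fin p, c j ^ p * g₀ ^ (j : ℕ)) = (u : K) * ∏ i : Fin m, ((t (Fin.castLE hmd i) : ↥(locAtCentre A'.toSubring O)) : K) ^ (a i)) ∨
    (∃ u : ↥(locAtCentre A'.toSubring O), IsUnit u ∧ (∑ j : Fin p, c j ^ p * g₀ ^ (j : ℕ)) = (u : K) ∧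
    ∀ c' : ↥(locAtCentre A'.toSubring O), u - c' ^ p ∉ IsLocalRing.maximalIdeal ↥(locAtCentre A'.toSubring O)) ∨
    (∃ s c' : ↥(locAtCentre A'.toSubring O), (∑ j : Fin p, c j ^ p * g₀ ^ (j : ℕ)) = (s : K) ∧
    s - c' ^ p ∈ IsLocalRing.maximalIdeal ↥(locAtCentre A'.toSubring O) ∧
    s - c' ^ p ∉ IsLocalRing.maximalIdeal ↥(locAtCentre A'.toSubring O) ^ 2)) :=
  cleanLU3Defect_of_divisorialCoarsening_of_cleanMono_cp hEmb hCP p hp k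
    (fun κ _ _ _ Ō Ā hĀŌ hĀfg hfr hregb hdimb hzdb ū hū => by
      haveI : Fact p.Prime := ⟨hp⟩
      haveI := hfr
      exact exists_cleanMono_stage_of_cases hEmb p (stub_cleanLU2 p hp k κ) (stub_persistCases p κ) (stub_persistE1 p κ)
        (stub_persistE2 p κ) Ō Ā hĀŌ hĀfg hregb hdimb hzdb ū hū)
    K O A hAO hAfg hfrac hdim3 hzd g₀ hg₀ hdefect O₁ hOO₁ hO₁ y hy hind

end Summit.ResolutionOfSingularities.ResolutionOfSingularities.Theorems.RadicialJung.CleanModels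

end
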